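import Literature.NumberTheory.EllipticCurves.HeegnerPointsRationalityProofs
import Literature.NumberTheory.EllipticCurves.HeegnerPointReflectionProofs
import Literature.NumberTheory.EllipticCurves.HeegnerPointsOfConductor
import Literature.NumberTheory.EllipticCurves.JZeroKolyvaginPrimes
import Summits.BirchSwinnertonDyer.BirchSwinnertonDyer.Theorems.SylvesterTwoHeegnerIndexLevelFixingOrbitFormW
import Literature.FieldTheory.AlgClosed.AutFixedSubfield
import HarnessLib

/-!
# (W2-b) `stub_levelFixingSeven` — FROM LEVEL TRANSPORT TO THE FIXED POINT: the two glue steps (P1 «fix of transport»,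
# P3 «descent to `pointGalHom`»), and the W-class `p ≡ 25 (mod 27)` reduced to ONE displayed transport hypothesis
# (crux `UpperOffV0HSYPlus`, stmt-BirchSwinnertonDyer-19804; route `SylvesterTwoHeegnerIndex`, rung K7t)

Cell `bsd-cm`, seat `bsd-cm-k7t-c2` g32 (the (W2-b) seat of record, planner D815/D816).  Helper toward
`stmt-BirchSwinnertonDyer-19804` (`--supports … --as helper`).  THEOREMS ONLY (no definition, no named fact, no instance,
no `sorry`).  Vocabulary: `ModularParametrizationData.φ`, `heegnerForms`/`heegnerTau`, `LevelTransport`, `sqrtDisc`,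
`ModularParametrizationData.isAutEquivariantOnHeegner` (PROVED in the tree, `HeegnerPointsRationalityProofs`),
`ringClassField K ι n ⊂ ℂ`, `pointGalHom` (`HeegnerPointsOfConductor`), `HeegnerForm.fricke` (`HeegnerPointReflectionProofs`),
`Complex.exists_ringEquiv_apply_eq_of_subfield` (`FieldTheory/AlgClosed/AutFixedSubfield`).

CONTEXT (seat memo `W2B-RECIPROCITY-k7t-c2-g32.md` v2 §4, evidence #53 on the crux item; crux idea
`Cruxes/UpperOffV0HSYPlus/Ideas/s3-fibre-transport-w2b.md` (bsd-idea-20 g49) items P1 «FixOfTransport» and P3 «glue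
FixOfTransport-conclusion → stub conclusion»).  The stub concludes `pointGalHom W₀ K[9pn] (φ.restrictScalars ℚ) y = y` for
the decomposition involution `φ` and a point `y ∈ E₉(K[9pn])` over `Dt.φ(τ_n)`.  Whatever route supplies the CM input
(HSY Thm 2.3 = (R1); the name-free (4.1)/(4.2); the card's `InvolutionTransport`+`LatticePairIdentity`), its output is a
LEVEL TRANSPORT `LevelTransport 243 σ τ_n τ′` for the automorphisms `σ` of `ℂ` extending `φ`, with `τ′` in the `S₃`-orbit of
`τ_n`; from there to the stub's conclusion only two glue steps remain, proved here once and for all: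

* ★ `map_φ_eq_self_of_levelTransport` (P1, any level `N`, any discriminant `D`, any datum): if `σ ∈ Aut(ℂ)` fixes `√D` and
  transports the level structure of `τ_Q` to that of `τ_{Q′}` (both Heegner forms of level `N`, discriminant `D`) and
  `Dt.φ(τ_{Q′}) = Dt.φ(τ_Q)` (e.g. `τ_{Q′} = g • τ_Q` with `Dt.φ ∘ g = Dt.φ`), then `σ` FIXES `Dt.φ(τ_Q)` — one call of
  `isAutEquivariantOnHeegner`;
* ★ `pointGalHom_eq_self_of_forall_ringEquiv` (P3, any `W/ℚ`, any `K`-automorphism `φ` of `K[n] ⊂ ℂ`): if EVERY automorphism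
  `σ` of `ℂ` extending `φ` fixes the complex image `P` of `y ∈ W(K[n])`, then `pointGalHom W K[n] (φ.restrictScalars ℚ) y = y`
  (extend `φ` to `σ` by `Complex.exists_ringEquiv_apply_eq_of_subfield` — `K[n]` is countable —, push `y` into `ℂ`,
  `Affine.Point.map_injective`); and `ringEquiv_apply_eq_of_extends` — such a `σ` fixes `ι(K)` pointwise (`φ` is `K`-linear);
* ★ `levelFixing_of_levelTransport_fricke` — THE W-CLASS OF THE STUB, REDUCED: under the stub's binders (`p ≡ 1 (mod 3)`
  suffices for the implication; it is the TRUE reduction on `p ≡ 25 (mod 27)`) and a Kolyvagin level `n`, for a degree-free datum `Dt` whose parametrisation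
  is `w₂₄₃`-invariant (`hW : ∀ τ, Dt.φ (w₂₄₃ • τ) = Dt.φ τ` — the W-half of (G3) = HSY Prop. 2.1 (1), admitted as a print
  binder by planner D816; typed by k-ty1 as `IsS3Invariant.frickeGL_smul`), and for ANY `K`-automorphism `φ` of `K[9pn]`:
  IF every `σ ∈ Aut(ℂ)` extending `φ` satisfies `LevelTransport 243 σ τ_n (w₂₄₃ • τ_n)` — stated with the Fricke partner
  `fricke 243 Q_n`, whose CM point IS `w₂₄₃ • τ_n` (`HeegnerForm.heegnerTau_fricke`) — THEN `φ` fixes every `y` over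
  `Dt.φ(τ_n)`.  The displayed hypothesis `hLT` is EXACTLY what Hu–Shu–Yin's Thm 2.3 + the kernel certificate
  `SylvesterTwoLevelFixingCert.levelCert_twentyFive` (p748342: `9ρ_n(√−3) ∈ V₃·W`) assert for the decomposition involution
  at `w = (√−3)`, and what the name-free routes (4.1)/(4.2) of the memo produce; nothing else of (W2-b) remains on this class.

NOT HERE: the classes `p ≡ 7, 16 (mod 27)` (partner `A^{±1}W·τ_n`; same two glue steps with `hA`); any proof of `hLT`;
(G2); the residue fact of the Fricke partner (sibling `…LevelFixingOrbitFormW.lean`, p748618, imported here for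
`fricke_sylvesterForm_mem_heegnerForms`; the residue congruence is what B-I needs, not this file).  HONEST LABEL: CONDITIONAL
(displayed `hLT`, `hW`); no stub closed; nothing asserted on 19804; X12.CMAtTwo NOT proved; BSD is proved for no curve.

## References
* Y. Hu, J. Shu, H. Yin, *An explicit Gross–Zagier formula related to the Sylvester conjecture*, Trans. AMS 372 (2019) =
  arXiv:1708.05266, §2.1 Prop. 2.1 (1) (`X₀(3⁵)/⟨W, A⟩ = E₉`), §2.2 Thm 2.3 (Shimura reciprocity), §4.1. [HuShuYin2019]
* H. Darmon, *Rational Points on Modular Elliptic Curves*, CBMS 101 (2004), Thm. 3.6–3.7 (Aut(ℂ)-equivariance of `Φ_N` on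
  CM points — the tree's `isAutEquivariantOnHeegner`). [Darmon2004]
* B. H. Gross, *Heegner points on `X₀(N)`* (1984), §I.1, §5. [Gross1984]
-/

set_option autoImplicit false
-- the Summit-side namespace `Summit.BirchSwinnertonDyer.BirchSwinnertonDyer.…` (summit = problem) is mandated by D-0017
set_option linter.dupNamespace false

noncomputable section

open scoped Cardinal

namespace Summit.BirchSwinnertonDyer.BirchSwinnertonDyer.Theorems.SylvesterTwoLevelFixingGlue

open Literature.NumberTheory.EllipticCurves Literature.NumberTheory.EllipticCurves.HeegnerForm
  Literature.NumberTheory.EllipticCurves.HuShuYin2019 Literature.NumberTheory.EllipticCurves.ModularForms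
  Literature.FieldTheory.AlgClosed WeierstrassCurve

/-! ## §1 P1 — fix of transport -/

/-- ★ **P1 (FIX OF TRANSPORT).**  For any parametrisation datum `Dt` at level `N`, any discriminant `D`, Heegner forms `Q, Q′`
of level `N` and discriminant `D`, and `σ ∈ Aut(ℂ)` fixing `√D` with `LevelTransport N σ τ_Q τ_{Q′}`: if `Dt.φ(τ_{Q′}) =
Dt.φ(τ_Q)` then `σ` fixes `Dt.φ(τ_Q) ∈ E(ℂ)`.  One call of the tree's PROVED `isAutEquivariantOnHeegner` (Darmon Thm 3.6/3.7,
Aut(ℂ)-form). [cite: Darmon2004, Thm. 3.6–3.7 (PDF pp. 43–44)] -/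
theorem map_φ_eq_self_of_levelTransport {N : ℕ} [NeZero N] {W : WeierstrassCurve ℚ}
    (Dt : ModularParametrizationData W N) {D : ℤ} {σ : ℂ ≃+* ℂ} (hσ : σ (sqrtDisc D) = sqrtDisc D)
    {Q Q' : ℤ × ℤ × ℤ} (hQ : Q ∈ heegnerForms N D) (hQ' : Q' ∈ heegnerForms N D)
    (hT : LevelTransport N σ (heegnerTau Q) (heegnerTau Q')) (hφ : Dt.φ (heegnerTau Q') = Dt.φ (heegnerTau Q)) :
    Affine.Point.map (W' := W) (σ : ℂ →+* ℂ).toRatAlgHom (Dt.φ (heegnerTau Q)) = Dt.φ (heegnerTau Q) := by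
  rw [Dt.isAutEquivariantOnHeegner D σ hσ hQ hQ' hT, hφ]

/-! ## §2 P3 — descent from `Aut(ℂ)` to `pointGalHom` on `W(K[n])` -/

variable {K : Type} [Field K] [NumberField K]

/-- An automorphism `σ` of `ℂ` extending a `K`-automorphism `φ` of `K[n] ⊂ ℂ` fixes `ι(K)` pointwise (`φ` commutes with
`algebraMap K K[n]`, whose composite with the inclusion is `ι`: `coe_algebraMap_ringClassField`). [folklore] -/
theorem ringEquiv_apply_eq_of_extends (ι : K →+* ℂ) (n : ℕ)
    (φ : ringClassField K ι n ≃ₐ[K] ringClassField K ι n) {σ : ℂ ≃+* ℂ}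
    (hσ : ∀ x : ringClassField K ι n, σ x = ((φ x : ringClassField K ι n) : ℂ)) (k : K) : σ (ι k) = ι k := by
  rw [← coe_algebraMap_ringClassField ι n k, hσ, AlgEquiv.commutes]

/-- ★ **P3 (DESCENT TO `pointGalHom`).**  Let `K` be imaginary quadratic, `ι : K → ℂ`, `n ≠ 0`, `W/ℚ`, `φ` a `K`-automorphism of
`K[n] = ringClassField K ι n ⊂ ℂ`, and `y ∈ W(K[n])` with complex image `P`.  If EVERY automorphism `σ` of `ℂ` extending `φ`
fixes `P`, then `pointGalHom W K[n] (φ.restrictScalars ℚ) y = y`.  (`K[n]` is countable, so `φ` extends to some `σ`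
(`Complex.exists_ringEquiv_apply_eq_of_subfield`); the image of `φ·y` in `W(ℂ)` is `σ·P = P`; `W(K[n]) → W(ℂ)` is injective.)
[folklore] -/
theorem pointGalHom_eq_self_of_forall_ringEquiv (hK : IsImaginaryQuadratic K) (ι : K →+* ℂ) {n : ℕ} (hn : n ≠ 0)
    (W : WeierstrassCurve ℚ) (φ : ringClassField K ι n ≃ₐ[K] ringClassField K ι n)
    (y : (W.baseChange (ringClassField K ι n)).toAffine.Point)
    (hfix : ∀ σ : ℂ ≃+* ℂ, (∀ x : ringClassField K ι n, σ x = ((φ x : ringClassField K ι n) : ℂ)) →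
      Affine.Point.map (W' := W) (σ : ℂ →+* ℂ).toRatAlgHom
          (Affine.Point.map (W' := W) (ringClassField K ι n).subtype.toRatAlgHom y) =
        Affine.Point.map (W' := W) (ringClassField K ι n).subtype.toRatAlgHom y) :
    pointGalHom W (ringClassField K ι n) (φ.restrictScalars ℚ) y = y := by
  -- `K[n]` is countable, so `φ` (followed by the inclusion) extends to an automorphism `σ` of `ℂ`
  have hcount : #(ringClassField K ι n) ≤ ℵ₀ := by
    haveI := (finiteDimensional_and_isGalois_ringClassField hK ι hn).1
    haveI : FiniteDimensional ℚ (ringClassField K ι n) := Module.Finite.trans K (ringClassField K ι n)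
    haveI : Algebra.IsAlgebraic ℚ (ringClassField K ι n) := Algebra.IsAlgebraic.of_finite ℚ _
    exact Subfield.cardinalMk_le_aleph0_of_isAlgebraic _
  obtain ⟨σ, hσ⟩ := Complex.exists_ringEquiv_apply_eq_of_subfield (ringClassField K ι n) hcount
    ((ringClassField K ι n).subtype.comp (φ : ringClassField K ι n ≃ₐ[K] ringClassField K ι n).toRingEquiv.toRingHom)
  have hσ' : ∀ x : ringClassField K ι n, σ x = ((φ x : ringClassField K ι n) : ℂ) := fun x ↦ by
    rw [hσ x]; rfl
  -- push into `W(ℂ)` and use injectivity of `W(K[n]) → W(ℂ)`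
  have key : Affine.Point.map (W' := W) (ringClassField K ι n).subtype.toRatAlgHom
        (pointGalHom W (ringClassField K ι n) (φ.restrictScalars ℚ) y) =
      Affine.Point.map (W' := W) (ringClassField K ι n).subtype.toRatAlgHom y := by
    calc Affine.Point.map (W' := W) (ringClassField K ι n).subtype.toRatAlgHom
          (pointGalHom W (ringClassField K ι n) (φ.restrictScalars ℚ) y)
        = Affine.Point.map (W' := W) (σ : ℂ →+* ℂ).toRatAlgHom
            (Affine.Point.map (W' := W) (ringClassField K ι n).subtype.toRatAlgHom y) := by
          rw [pointGalHom_apply, Affine.Point.map_map, Affine.Point.map_map]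
          exact Affine.Point.map_congr_fun (fun x ↦ (hσ' x).symm) _
      _ = Affine.Point.map (W' := W) (ringClassField K ι n).subtype.toRatAlgHom y := hfix σ hσ'
  exact Affine.Point.map_injective _ key

/-! ## §3 The W-class `p ≡ 25 (mod 27)` of the stub, reduced to ONE displayed level-transport hypothesis -/

/-- `√((9pn)²·(−3)) = 9pn · √(−3)` for the normalised square roots `sqrtDisc` (private helper). [folklore] -/
private theorem sqrtDisc_sylvester (p n : ℕ) :
    sqrtDisc (((9 * p * n : ℕ) : ℤ) ^ 2 * (-3)) = ((9 * p * n : ℕ) : ℂ) * sqrtDisc (-3) := by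
  unfold sqrtDisc
  have hm : (0 : ℝ) ≤ ((9 * p * n : ℕ) : ℝ) := Nat.cast_nonneg _
  have h : -((((9 * p * n : ℕ) : ℤ) ^ 2 * (-3) : ℤ) : ℝ) = (((9 * p * n : ℕ) : ℝ)) ^ 2 * (-((-3 : ℤ) : ℝ)) := by
    push_cast; ring
  rw [h, Real.sqrt_mul (sq_nonneg _), Real.sqrt_sq hm]
  push_cast
  ring

/-- ★ **(W2-b) REDUCED TO ONE TRANSPORT HYPOTHESIS, FRICKE FORM (the true one on the W-class `p ≡ 25 (mod 27)`).**
Binders as in `stub_levelFixingSeven`: `p ≡ 1 (mod 3)` (the stub has `p ≡ 7 (mod 9)`), `K ∋ ω` with `ω² + ω + 1 = 0`, `[K:ℚ] = 2`, `ι`, `n ≠ 0` with all prime factors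
`≡ 2 (mod 3)`, a datum `Dt : ModularParametrizationData ⟨0,0,1,0,−1⟩ 243` whose parametrisation is `w₂₄₃`-INVARIANT
(`hW`, the W-half of HSY Prop. 2.1 (1) = (G3), a displayed print input), a point `y ∈ E₉(K[9pn])` over `Dt.φ(τ_n)`, and ANY
`K`-automorphism `φ` of `K[9pn]`.  HYPOTHESIS DISPLAYED: `hLT` — every automorphism `σ` of `ℂ` extending `φ` transports the
level-`243` structure of `τ_n` to that of the Fricke partner `fricke 243 Q_n` (whose CM point is `w₂₄₃ • τ_n`) — which is
what Hu–Shu–Yin's Thm 2.3 with `SylvesterTwoLevelFixingCert.levelCert_twentyFive` (`9ρ_n(√−3) ∈ V₃·W`) gives for the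
decomposition involution at `w = (√−3)` WHEN `p ≡ 25 (mod 27)` (on the other two classes the true target is `A^{±1}W·τ_n` and
this `hLT` is false for the decomposition involution — the implication below is nevertheless stated for every `p ≡ 1 (mod 3)`),
and what the memo's name-free routes (4.1)/(4.2) are to produce there.  CONCLUSION: the
stub's, `pointGalHom E₉ K[9pn] (φ.restrictScalars ℚ) y = y`.  Proof: P3 ∘ P1 with `Q′ = fricke 243 Q_n`
(`sylvesterForm_mem_heegnerForms`, the sibling's `fricke_sylvesterForm_mem_heegnerForms` (p748618) for `Q′ ∈ heegnerForms`,
`heegnerTau_fricke` + `hW` for `Dt.φ(τ_{Q′}) = Dt.φ(τ_n)`).  CONDITIONAL (`hLT`, `hW`); no stub closed; BSD is not proved by any of this.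
[cite: HuShuYin2019, §2.1 Prop. 2.1 (1), §2.2 Thm 2.3, §4.1] [cite: Gross1984, §I.1, §5] -/
theorem levelFixing_of_levelTransport_fricke
    (Dt : ModularParametrizationData (⟨0, 0, 1, 0, -1⟩ : WeierstrassCurve ℚ) 243)
    (hW : ∀ τ : UpperHalfPlane, Dt.φ (glCast (frickeGL 243 : GL (Fin 2) ℚ) • τ) = Dt.φ τ)
    {p : ℕ} (hp3 : p % 3 = 1) {ω : K} (hω : ω ^ 2 + ω + 1 = 0) (h2 : Module.finrank ℚ K = 2)
    (ι : K →+* ℂ) {n : ℕ} (hn : n ≠ 0) (hprimes : ∀ q ∈ n.primeFactors, q % 3 = 2)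
    (φ : ringClassField K ι (9 * p * n) ≃ₐ[K] ringClassField K ι (9 * p * n))
    (hLT : ∀ σ : ℂ ≃+* ℂ, (∀ x : ringClassField K ι (9 * p * n), σ x = ((φ x : ringClassField K ι (9 * p * n)) : ℂ)) →
      LevelTransport 243 σ
        (heegnerTau ((n : ℤ) ^ 2 * (81 * ((p : ℤ) ^ 2 + 4 * p + 16)),
          (n : ℤ) * (-(9 * (4 * (p : ℤ) ^ 2 + 17 * p + 72))), 4 * (p : ℤ) ^ 2 + 18 * p + 81))
        (heegnerTau (fricke 243 ((n : ℤ) ^ 2 * (81 * ((p : ℤ) ^ 2 + 4 * p + 16)),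
          (n : ℤ) * (-(9 * (4 * (p : ℤ) ^ 2 + 17 * p + 72))), 4 * (p : ℤ) ^ 2 + 18 * p + 81))))
    (y : (((⟨0, 0, 1, 0, -1⟩ : WeierstrassCurve ℚ)).baseChange (ringClassField K ι (9 * p * n))).toAffine.Point)
    (hy : Affine.Point.map (W' := (⟨0, 0, 1, 0, -1⟩ : WeierstrassCurve ℚ))
        (ringClassField K ι (9 * p * n)).subtype.toRatAlgHom y =
      Dt.φ (heegnerTau ((n : ℤ) ^ 2 * (81 * ((p : ℤ) ^ 2 + 4 * p + 16)),
        (n : ℤ) * (-(9 * (4 * (p : ℤ) ^ 2 + 17 * p + 72))), 4 * (p : ℤ) ^ 2 + 18 * p + 81))) :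
    pointGalHom (⟨0, 0, 1, 0, -1⟩ : WeierstrassCurve ℚ) (ringClassField K ι (9 * p * n)) (φ.restrictScalars ℚ) y = y := by
  have hK : IsImaginaryQuadratic K := JZero.isImaginaryQuadratic_of_sq_add_self_add_one hω h2
  have hdK : NumberField.discr K = -3 := JZero.discr_eq_neg_three_of_sq_add_self_add_one hω h2
  have hp0 : 0 < p := by omega
  have hm : 9 * p * n ≠ 0 := Nat.mul_ne_zero (Nat.mul_ne_zero (by norm_num) hp0.ne') hn
  have hn3 : ¬ 3 ∣ n := by
    intro h
    have h3 := hprimes 3 (Nat.mem_primeFactors.mpr ⟨Nat.prime_three, h, hn⟩)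
    omega
  have hnC := isCoprime_C_of_forall_prime_mod_three_eq_two (p := p) hn hprimes
  have hQ := sylvesterForm_mem_heegnerForms hp3 hn hnC
  have hQ' := SylvesterTwoLevelFixingOrbit.fricke_sylvesterForm_mem_heegnerForms hp3 hn hn3 hnC
  -- the CM point of the Fricke partner is `w₂₄₃ • τ_n`, where `Dt.φ` takes the same value
  have hφ' : Dt.φ (heegnerTau (fricke 243 ((n : ℤ) ^ 2 * (81 * ((p : ℤ) ^ 2 + 4 * p + 16)),
        (n : ℤ) * (-(9 * (4 * (p : ℤ) ^ 2 + 17 * p + 72))), 4 * (p : ℤ) ^ 2 + 18 * p + 81))) =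
      Dt.φ (heegnerTau ((n : ℤ) ^ 2 * (81 * ((p : ℤ) ^ 2 + 4 * p + 16)),
        (n : ℤ) * (-(9 * (4 * (p : ℤ) ^ 2 + 17 * p + 72))), 4 * (p : ℤ) ^ 2 + 18 * p + 81)) := by
    obtain ⟨hdisc, hA, hNA, -⟩ := hQ
    have hdisc' : ((n : ℤ) * (-(9 * (4 * (p : ℤ) ^ 2 + 17 * p + 72)))) ^ 2 -
        4 * ((n : ℤ) ^ 2 * (81 * ((p : ℤ) ^ 2 + 4 * p + 16))) * (4 * (p : ℤ) ^ 2 + 18 * p + 81) < 0 := by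
      have h : ((n : ℤ) * (-(9 * (4 * (p : ℤ) ^ 2 + 17 * p + 72)))) ^ 2 -
          4 * ((n : ℤ) ^ 2 * (81 * ((p : ℤ) ^ 2 + 4 * p + 16))) * (4 * (p : ℤ) ^ 2 + 18 * p + 81) =
          -(243 * ((p : ℤ) * n) ^ 2) := by ring
      rw [h]
      have hp0' : (0 : ℤ) < p := by exact_mod_cast hp0
      have hn0 : (0 : ℤ) < n := by exact_mod_cast Nat.pos_of_ne_zero hn
      nlinarith [mul_pos hp0' hn0]
    rw [heegnerTau_fricke (N := 243) hA hdisc' hNA, hW]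
  refine pointGalHom_eq_self_of_forall_ringEquiv hK ι hm _ φ y fun σ hσ ↦ ?_
  -- `σ` fixes `ι(K)`, hence `√((9pn)²·(−3))`
  have hσK : ∀ k : K, σ (ι k) = ι k := ringEquiv_apply_eq_of_extends ι (9 * p * n) φ hσ
  have hσD : σ (sqrtDisc (((9 * p * n : ℕ) : ℤ) ^ 2 * (-3))) = sqrtDisc (((9 * p * n : ℕ) : ℤ) ^ 2 * (-3)) := by
    have h3 : σ (sqrtDisc (-3)) = sqrtDisc (-3) := by
      have h := apply_sqrtDisc_discr_eq hK ι hσK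
      rwa [hdK] at h
    rw [sqrtDisc_sylvester, map_mul, map_natCast, h3]
  rw [hy]
  exact map_φ_eq_self_of_levelTransport Dt hσD hQ hQ' (hLT σ hσ) hφ'

end Summit.BirchSwinnertonDyer.BirchSwinnertonDyer.Theorems.SylvesterTwoLevelFixingGlue

end
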